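import Mathlib

/-!
# Perfect matchings of `G □ K₂` project onto pairs of perfect matchings of induced subgraphs of `G` (Anand–Chen–Cryan–Freifeld–Goldberg–Guo–Zhang 2025, Lemma 4.1)

Cell `pub-qadeq` (summit `QuantumAdvantage`), CLAIMS rows A-192 / A-30 (Gaussian-boson-sampling graph
applications) and §1 OPEN-70.
HONEST FRAMING: instance-level adjudication of specific advantage claims; no claim about BQP vs BPP
or the summit.

**Source.** K. Anand, Z. Chen, M. Cryan, G. Freifeld, L. A. Goldberg, H. Guo, X. Zhang, *Simulating
Gaussian boson sampling on graphs in polynomial time*, arXiv:2511.16558v2 (2025/26)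
[AnandChenCryanFreifeldGoldbergGuoZhang2025], §4 (materialised text `paper:arxiv-2511.16558`,
chunks p0013–p0014):

> "The sampling algorithm … takes the input graph `G = (V, E)` and constructs the graph `G □ K₂`,
> which is the Cartesian product of `G` and an edge. In order to construct `G □ K₂`, we start with a
> copy `G′ = (V′, E′)` of `G`. Then `E₀ = {(v, v′) : v ∈ V}` and `G □ K₂ = (V ∪ V′, E ∪ E′ ∪ E₀)`.
> … for each edge `e ∈ E ∪ E′`, let `λ_e = c²`, and for each `e ∈ E₀`, let `λ_e = 1`. Suppose that `M`
> is a sample from the perfect matching distribution (4) on the graph `G □ K₂` with this weight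
> function `λ`. Let `S_M ⊂ V` be the set of vertices that are endpoints of some edge in `M ∩ E`. …
> **Lemma 4.1.** The induced distribution of `S_M` is exactly `μ_GBS,G(S)` [`∝ c^{2|S|} Haf(A_S)²`,
> eq. (9)]. *Proof.* For `M ∼ μ_PM,λ`, as it is a perfect matching of `G □ K₂`, each vertex `v` in
> `V` is either matched with an edge in `M ∩ E` or `M ∩ E₀`. If `v` is matched in `E₀` then it is
> matched with its copy `v′`. Thus the set of endpoints of edges in `M ∩ E′`, denoted `S′`, is the set
> of copies of vertices in `S_M`. … `= c^{2|S|} Haf[A_S]²`."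

What is formalised (the COMBINATORIAL CONTENT of Lemma 4.1, from which the distributional statement
is the one-line consequence "weight is constant `c^{2|S|}` on the fibre over `S`, and the fibre has
`Haf(A_S)² = PM(G[S])²` elements"):

* `IsPerfectMatchingFun H σ` / `PMFun H`: a perfect matching of a simple graph `H` on `W`, presented as
  a map `σ : W → W` with `H.Adj w (σ w)` and `σ (σ w) = w` for all `w` (a fixed-point-free involution
  along edges — each perfect matching corresponds to exactly one such `σ`, its "partner" map).
* `layerSet σ : Finset V` for `σ : PMFun (G □ ⊤)` on `V × Bool` (`⊤` on `Bool` is `K₂`): the vertices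
  `v` whose top copy `(v, true)` is matched inside its layer — the paper's `S_M`.
* `snd_partner_eq_iff` : the two copies of `v` are matched in-layer or by the rung TOGETHER (the
  sentence "If `v` is matched in `E₀` then it is matched with its copy `v′` … `S′` is the set of copies
  of vertices in `S_M`").
* `fibreEquiv G S : {σ : PMFun (G □ ⊤) // layerSet σ = S} ≃ PMFun (G.induce S) × PMFun (G.induce S)`
  and `card_fibre_eq_sq : Nat.card {σ // layerSet σ = S} = (Nat.card (PMFun (G.induce S)))²` — the
  count `Haf(A_S)²` of the fibre.
* `card_inLayer_eq` : on the fibre over `S` the number of in-layer-matched vertices of `G □ K₂` is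
  `2·|S|`, i.e. with weight `c` per matched endpoint of a `G`- or `G′`-edge (= `c²` per such edge, the
  paper's `λ`) every matching in the fibre has weight `c^{2|S|}`.

Mathlib supplies the box product `SimpleGraph.boxProd` (`□`), `⊤ : SimpleGraph Bool` as `K₂`, and
`SimpleGraph.induce`; it has `Subgraph.IsPerfectMatching` but no counting API, hence the function
presentation here (standard: a perfect matching is the same thing as a fixed-point-free involution
whose orbits are edges). 0 named facts, 0 sorry.
-/

namespace Literature.Combinatorics.SimpleGraph.BoxProdEdgePerfectMatchings

open SimpleGraph Finset

/-! ### 1. Perfect matchings as partner maps -/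

/-- A perfect matching of `H`, presented by its partner map: every vertex is adjacent to its partner
and partnership is an involution. [cite: AnandChenCryanFreifeldGoldbergGuoZhang2025, §2 eq. (4) ("the set of perfect matchings") and §4 Lemma 4.1]; [folklore] -/
def IsPerfectMatchingFun {W : Type*} (H : SimpleGraph W) (σ : W → W) : Prop :=
  (∀ w, H.Adj w (σ w)) ∧ ∀ w, σ (σ w) = w

/-- The type of perfect matchings of `H` (as partner maps). [cite: AnandChenCryanFreifeldGoldbergGuoZhang2025, §2 eq. (4)] -/
def PMFun {W : Type*} (H : SimpleGraph W) : Type _ := {σ : W → W // IsPerfectMatchingFun H σ}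

variable {V : Type*} (G : SimpleGraph V)

/-- `G □ K₂`: the Cartesian product of `G` with an edge, on the vertex set `V × Bool` (layer `true` =
the copy `G`, layer `false` = the copy `G′`; the rungs `E₀` join `(v, true)` and `(v, false)`).
[cite: AnandChenCryanFreifeldGoldbergGuoZhang2025, §4 ("G □ K₂ = (V ∪ V′, E ∪ E′ ∪ E₀)")] -/
abbrev boxK2 : SimpleGraph (V × Bool) := G □ (⊤ : SimpleGraph Bool)

/-- Adjacency in `G □ K₂`: in-layer along a `G`-edge (`E ∪ E′`), or across the rung `E₀` to the own
copy. [cite: AnandChenCryanFreifeldGoldbergGuoZhang2025, §4 ("E₀ = {(v, v′) : v ∈ V} and G □ K₂ = (V ∪ V′, E ∪ E′ ∪ E₀)")] -/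
theorem boxK2_adj (x y : V × Bool) :
    (boxK2 G).Adj x y ↔ G.Adj x.1 y.1 ∧ x.2 = y.2 ∨ x.2 ≠ y.2 ∧ x.1 = y.1 := by
  rw [boxK2, _root_.SimpleGraph.boxProd_adj, _root_.SimpleGraph.top_adj]

variable {G}

/-! ### 2. The layer set `S_M` and the rung dichotomy -/

/-- For a perfect matching `σ` of `G □ K₂`: a vertex is matched IN its layer iff its partner has the
same second coordinate; otherwise it is matched by its rung, to its own copy.
[cite: AnandChenCryanFreifeldGoldbergGuoZhang2025, §4 proof of Lemma 4.1 ("each vertex v in V is either matched with an edge in M ∩ E or M ∩ E₀. If v is matched in E₀ then it is matched with its copy v′")] -/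
theorem partner_cases (σ : PMFun (boxK2 G)) (x : V × Bool) :
    (G.Adj x.1 (σ.1 x).1 ∧ (σ.1 x).2 = x.2) ∨ σ.1 x = (x.1, !x.2) := by
  have h := (boxK2_adj G x (σ.1 x)).1 (σ.2.1 x)
  rcases h with ⟨hadj, h2⟩ | ⟨h2, h1⟩
  · exact Or.inl ⟨hadj, h2.symm⟩
  · right
    ext
    · exact h1.symm
    · revert h2; cases x.2 <;> cases (σ.1 x).2 <;> simp

/-- If `x` is matched in-layer then its partner is not its rung copy. [folklore] -/
private theorem partner_ne_copy_of_inLayer (σ : PMFun (boxK2 G)) (x : V × Bool)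
    (h : (σ.1 x).2 = x.2) : σ.1 x ≠ (x.1, !x.2) := by
  intro e
  rw [e] at h
  revert h; cases x.2 <;> simp

/-- **The two copies move together.** `(v, true)` is matched in-layer iff `(v, false)` is
("the set of endpoints of edges in `M ∩ E′` … is the set of copies of vertices in `S_M`").
[cite: AnandChenCryanFreifeldGoldbergGuoZhang2025, §4 proof of Lemma 4.1] -/
theorem snd_partner_eq_iff (σ : PMFun (boxK2 G)) (v : V) :
    (σ.1 (v, true)).2 = true ↔ (σ.1 (v, false)).2 = false := by
  constructor
  · intro ht
    rcases partner_cases σ (v, false) with ⟨_, h2⟩ | hr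
    · exact h2
    · -- `(v,false)` on the rung ⇒ `σ (v,true) = (v,false)`, contradicting `ht`
      exfalso
      have e : σ.1 (v, true) = (v, false) := by
        have := σ.2.2 (v, false)
        rw [hr] at this
        simpa using this
      rw [e] at ht
      simp at ht
  · intro hf
    rcases partner_cases σ (v, true) with ⟨_, h2⟩ | hr
    · exact h2
    · exfalso
      have e : σ.1 (v, false) = (v, true) := by
        have := σ.2.2 (v, true)
        rw [hr] at this
        simpa using this
      rw [e] at hf
      simp at hf

/-- In-layer at `(v, b)` iff in-layer at `(v, true)` (both copies of `v` are matched in-layer, or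
both by their rung). [cite: AnandChenCryanFreifeldGoldbergGuoZhang2025, §4 proof of Lemma 4.1 ("S′ is the set of copies of vertices in S_M")] -/
theorem inLayer_iff_top (σ : PMFun (boxK2 G)) (v : V) (b : Bool) :
    (σ.1 (v, b)).2 = b ↔ (σ.1 (v, true)).2 = true := by
  cases b
  · exact (snd_partner_eq_iff σ v).symm
  · exact Iff.rfl

/-- An in-layer partner of a vertex of `S_M × {b}` lies again in `S_M × {b}` and is a `G`-neighbour.
[cite: AnandChenCryanFreifeldGoldbergGuoZhang2025, §4 proof of Lemma 4.1] -/
theorem partner_inLayer (σ : PMFun (boxK2 G)) {v : V} (b : Bool)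
    (hv : (σ.1 (v, true)).2 = true) :
    G.Adj v (σ.1 (v, b)).1 ∧ (σ.1 (v, b)).2 = b ∧ (σ.1 ((σ.1 (v, b)).1, true)).2 = true := by
  have hb : (σ.1 (v, b)).2 = b := (inLayer_iff_top σ v b).2 hv
  rcases partner_cases σ (v, b) with ⟨hadj, h2⟩ | hr
  · refine ⟨hadj, hb, ?_⟩
    -- the partner `(v', b)` is itself matched in-layer (its partner is `(v, b)`)
    have hpart : σ.1 ((σ.1 (v, b)).1, b) = (v, b) := by
      have e : ((σ.1 (v, b)).1, b) = σ.1 (v, b) := by ext <;> simp [hb]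
      rw [e]; exact σ.2.2 (v, b)
    have : (σ.1 ((σ.1 (v, b)).1, b)).2 = b := by rw [hpart]
    exact (inLayer_iff_top σ _ b).1 this
  · exact absurd hr (partner_ne_copy_of_inLayer σ (v, b) hb)

variable [Fintype V]

/-- The paper's `S_M`: vertices whose (top) copy is matched inside its layer.
[cite: AnandChenCryanFreifeldGoldbergGuoZhang2025, §4 ("Let S_M ⊂ V be the set of vertices that are endpoints of some edge in M ∩ E")] -/
def layerSet (σ : PMFun (boxK2 G)) : Finset V :=
  Finset.univ.filter fun v => (σ.1 (v, true)).2 = true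

/-- Membership in `S_M`: `v ∈ S_M` iff the copy `v ∈ V` is an endpoint of an edge of `M ∩ E`, i.e. is
matched inside its layer. [cite: AnandChenCryanFreifeldGoldbergGuoZhang2025, §4 ("Let S_M ⊂ V be the set of vertices that are endpoints of some edge in M ∩ E")] -/
theorem mem_layerSet (σ : PMFun (boxK2 G)) (v : V) :
    v ∈ layerSet σ ↔ (σ.1 (v, true)).2 = true := by
  simp [layerSet]

/-! ### 3. The fibre over `S` is `PM(G[S]) × PM(G[S])` -/

section fibre

variable [DecidableEq V] (G) (S : Finset V)

omit [DecidableEq V] in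
/-- Members of `S` are matched in-layer by every matching of the fibre over `S`. [folklore] -/
private theorem inLayer_of_fibre (σ : {σ : PMFun (boxK2 G) // layerSet σ = S}) (x : (S : Set V)) :
    (σ.1.1 (x.1, true)).2 = true := by
  have h : (x.1 : V) ∈ layerSet σ.1 := by
    rw [σ.2]
    exact_mod_cast x.2
  exact (mem_layerSet σ.1 x.1).1 h

/-- Restriction of a matching in the fibre over `S` to the layer `b`, as a perfect matching of the
induced subgraph `G[S]`. [cite: AnandChenCryanFreifeldGoldbergGuoZhang2025, §4 proof of Lemma 4.1] -/
def restrictLayer (σ : {σ : PMFun (boxK2 G) // layerSet σ = S}) (b : Bool) :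
    PMFun (G.induce (S : Set V)) :=
  ⟨fun x =>
    ⟨(σ.1.1 (x.1, b)).1, by
      have hx : (σ.1.1 (x.1, true)).2 = true := inLayer_of_fibre G S σ x
      have h := (partner_inLayer σ.1 b hx).2.2
      have : (σ.1.1 (x.1, b)).1 ∈ layerSet σ.1 := (mem_layerSet _ _).2 h
      rw [σ.2] at this
      exact this⟩,
   by
    refine ⟨fun x => ?_, fun x => ?_⟩
    · have hx : (σ.1.1 (x.1, true)).2 = true := inLayer_of_fibre G S σ x
      exact (_root_.SimpleGraph.induce_adj).2 (partner_inLayer σ.1 b hx).1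
    · have hx : (σ.1.1 (x.1, true)).2 = true := inLayer_of_fibre G S σ x
      have hb : (σ.1.1 (x.1, b)).2 = b := (partner_inLayer σ.1 b hx).2.1
      apply Subtype.ext
      show (σ.1.1 ((σ.1.1 (x.1, b)).1, b)).1 = x.1
      have e : ((σ.1.1 (x.1, b)).1, b) = σ.1.1 (x.1, b) := by ext <;> simp [hb]
      rw [e, σ.1.2.2]⟩

/-- Gluing two perfect matchings of `G[S]` (one per layer) with rungs on `V ∖ S` gives a perfect
matching of `G □ K₂` in the fibre over `S`. [cite: AnandChenCryanFreifeldGoldbergGuoZhang2025, §4 proof of Lemma 4.1] -/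
def glue (τ : PMFun (G.induce (S : Set V)) × PMFun (G.induce (S : Set V))) :
    {σ : PMFun (boxK2 G) // layerSet σ = S} := by
  classical
  let f : V × Bool → V × Bool := fun x =>
    if h : x.1 ∈ S then
      (((if x.2 then τ.1 else τ.2).1 ⟨x.1, by exact_mod_cast h⟩ : (S : Set V)).1, x.2)
    else (x.1, !x.2)
  have hf_in : ∀ (v : V) (b : Bool) (h : v ∈ S),
      f (v, b) = (((if b then τ.1 else τ.2).1 ⟨v, by exact_mod_cast h⟩ : (S : Set V)).1, b) := by
    intro v b h; simp [f, h]
  have hf_out : ∀ (v : V) (b : Bool), v ∉ S → f (v, b) = (v, !b) := by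
    intro v b h; simp [f, h]
  refine ⟨⟨f, ?_, ?_⟩, ?_⟩
  · -- adjacency
    rintro ⟨v, b⟩
    rw [boxK2_adj]
    by_cases h : v ∈ S
    · left
      rw [hf_in v b h]
      refine ⟨?_, rfl⟩
      have := ((if b then τ.1 else τ.2).2.1 ⟨v, by exact_mod_cast h⟩)
      exact (_root_.SimpleGraph.induce_adj).1 this
    · right
      rw [hf_out v b h]
      cases b <;> simp
  · -- involution
    rintro ⟨v, b⟩
    by_cases h : v ∈ S
    · set ρ := (if b then τ.1 else τ.2) with hρ
      have hmem : (ρ.1 ⟨v, by exact_mod_cast h⟩ : (S : Set V)).1 ∈ S := by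
        exact_mod_cast (ρ.1 ⟨v, by exact_mod_cast h⟩).2
      rw [hf_in v b h, ← hρ, hf_in _ b hmem, ← hρ]
      ext
      · show (ρ.1 ⟨(ρ.1 ⟨v, _⟩).1, _⟩).1 = v
        have e : (⟨(ρ.1 ⟨v, by exact_mod_cast h⟩).1, by exact_mod_cast hmem⟩ : (S : Set V))
            = ρ.1 ⟨v, by exact_mod_cast h⟩ := Subtype.ext rfl
        rw [e, ρ.2.2]
      · rfl
    · rw [hf_out v b h, hf_out v (!b) h]
      cases b <;> rfl
  · -- layer set
    ext v
    rw [mem_layerSet]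
    show (f (v, true)).2 = true ↔ v ∈ S
    by_cases h : v ∈ S
    · rw [hf_in v true h]; simp [h]
    · rw [hf_out v true h]; simp [h]

/-- The glued matching on a vertex of `S × {b}`: the partner given by the `b`-th component. [folklore] -/
private theorem glue_apply_in (τ : PMFun (G.induce (S : Set V)) × PMFun (G.induce (S : Set V)))
    (v : V) (b : Bool) (h : v ∈ S) :
    (glue G S τ).1.1 (v, b)
      = (((if b then τ.1 else τ.2).1 ⟨v, by exact_mod_cast h⟩ : (S : Set V)).1, b) := by
  classical
  simp [glue, h]

/-- The glued matching outside `S`: the rung. [folklore] -/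
private theorem glue_apply_out (τ : PMFun (G.induce (S : Set V)) × PMFun (G.induce (S : Set V)))
    (v : V) (b : Bool) (h : v ∉ S) :
    (glue G S τ).1.1 (v, b) = (v, !b) := by
  classical
  simp [glue, h]

/-- **Lemma 4.1 (combinatorial core): the fibre of `S_M = S` is `PM(G[S]) × PM(G[S])`.**
[cite: AnandChenCryanFreifeldGoldbergGuoZhang2025, §4 Lemma 4.1 (proof: "= c^{2|S|} Haf[A_S]²")] -/
def fibreEquiv :
    {σ : PMFun (boxK2 G) // layerSet σ = S}
      ≃ PMFun (G.induce (S : Set V)) × PMFun (G.induce (S : Set V)) where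
  toFun σ := (restrictLayer G S σ true, restrictLayer G S σ false)
  invFun τ := glue G S τ
  left_inv σ := by
    apply Subtype.ext; apply Subtype.ext
    funext x
    obtain ⟨v, b⟩ := x
    by_cases h : v ∈ S
    · rw [glue_apply_in G S _ v b h]
      have hS : v ∈ layerSet σ.1 := by rw [σ.2]; exact h
      have hx : (σ.1.1 (v, true)).2 = true := (mem_layerSet σ.1 v).1 hS
      have hb : (σ.1.1 (v, b)).2 = b := (partner_inLayer σ.1 b hx).2.1
      ext
      · cases b <;> rfl
      · exact hb.symm
    · rw [glue_apply_out G S _ v b h]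
      have hx : ¬ (σ.1.1 (v, true)).2 = true := by
        intro hh
        have : v ∈ layerSet σ.1 := (mem_layerSet σ.1 v).2 hh
        rw [σ.2] at this
        exact h this
      rcases partner_cases σ.1 (v, b) with ⟨_, h2⟩ | hr
      · exact absurd ((inLayer_iff_top σ.1 v b).1 h2) hx
      · exact hr.symm
  right_inv τ := by
    refine Prod.ext (Subtype.ext (funext fun x => Subtype.ext ?_))
      (Subtype.ext (funext fun x => Subtype.ext ?_))
    · show (((glue G S τ).1.1 (x.1, true)).1) = (τ.1.1 x).1
      rw [glue_apply_in G S τ x.1 true (by exact_mod_cast x.2)]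
      rfl
    · show (((glue G S τ).1.1 (x.1, false)).1) = (τ.2.1 x).1
      rw [glue_apply_in G S τ x.1 false (by exact_mod_cast x.2)]
      rfl

/-- **`|fibre over S| = PM(G[S])² = Haf(A_S)²`.**
[cite: AnandChenCryanFreifeldGoldbergGuoZhang2025, §4 Lemma 4.1] -/
theorem card_fibre_eq_sq :
    Nat.card {σ : PMFun (boxK2 G) // layerSet σ = S}
      = Nat.card (PMFun (G.induce (S : Set V))) ^ 2 := by
  rw [Nat.card_congr (fibreEquiv G S), Nat.card_prod, sq]

omit [DecidableEq V] in
/-- **Constant weight on the fibre.** For `σ` in the fibre over `S`, the vertices of `G □ K₂` matched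
inside their layer are exactly `S × {true, false}`, so their number is `2|S|`: with weight `c` per
matched endpoint of an `E ∪ E′` edge (equivalently `λ_e = c²` per such edge and `λ_e = 1` per rung)
every matching in the fibre weighs `c^{2|S|}`. [cite: AnandChenCryanFreifeldGoldbergGuoZhang2025, §4 Lemma 4.1 (weights λ_e = c² on E ∪ E′, 1 on E₀; "= c^{2|S|} Haf[A_S]²")] -/
theorem card_inLayer_eq (σ : PMFun (boxK2 G)) (hσ : layerSet σ = S) :
    (Finset.univ.filter fun x : V × Bool => (σ.1 x).2 = x.2).card = 2 * S.card := by
  have e : (Finset.univ.filter fun x : V × Bool => (σ.1 x).2 = x.2) = S ×ˢ Finset.univ := by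
    ext ⟨v, b⟩
    simp only [Finset.mem_filter, Finset.mem_univ, true_and, Finset.mem_product, and_true]
    rw [inLayer_iff_top σ v b, ← mem_layerSet σ v, hσ]
  rw [e, Finset.card_product, Finset.card_univ, Fintype.card_bool, mul_comm]

end fibre

end Literature.Combinatorics.SimpleGraph.BoxProdEdgePerfectMatchings
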